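import Summits.Parity.GeneralizedHardyLittlewood.Theorems.LeeYangFibresAbsoluteUpgradeDipDefs
import HarnessLib

/-!
# Route `LeeYangFibres`, crux `AbsoluteUpgrade` (stmt-Parity-14116), line `dip-margin-rate-exchange`:
# numerics of the roughness schedule (helper for the stub `stub_quantClip`)

Helper file 3/· for the registered stub `stub_quantClip`: two elementary real-variable facts about the schedule
`U(N) = slowDegree N = max 4 ⌊√(log log N)/2⌋`.

* `quantClip_powSelf_le_exp` — for `δ > 0`, `p`, `c`: `c · U^{U+p} ≤ exp(δ U²)` for all `U ≥ U₀(δ, p, c)`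
  (`log U ≤ (δ/2) U + |log(δ/2)|` from `log x ≤ x - 1`, so `log c + (U+p) log U ≤ δ U²` for large `U`) — this is
  why the law's saving `(log N)^{-δ} = exp(-4δU²(1+o(1)))` beats the margin's floor `U^{-U}`;
* `quantClip_schedule` (registered helper) — for every `U₀` and all large `N`: `U₀ ≤ U(N)`, `16 ≤ N`,
  `exp(4 U(N)²) ≤ log N` and `log log N ≤ (2 U(N) + 2)²` (so `(log log N)^{t-1}` is a power of `U(N)`).

No named facts are used.
-/

noncomputable section

namespace Summit.Parity.GeneralizedHardyLittlewood.Cruxes.AbsoluteUpgrade.DipMarginRateExchange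

open scoped BigOperators

/-- **`U^U` loses against `exp(δ U²)`.**  For `δ > 0`, `p : ℕ` and `c : ℝ` there is `U₀` with
`c U^{U+p} ≤ exp(δ U²)` for all natural `U ≥ U₀`. -/
theorem quantClip_powSelf_le_exp {δ : ℝ} (hδ : 0 < δ) (p : ℕ) (c : ℝ) :
    ∃ U₀ : ℕ, ∀ U : ℕ, U₀ ≤ U → c * (U : ℝ) ^ (U + p) ≤ Real.exp (δ * (U : ℝ) ^ 2) := by
  by_cases hc : c ≤ 0
  · exact ⟨0, fun U _ =>
      le_trans (mul_nonpos_of_nonpos_of_nonneg hc (by positivity)) (Real.exp_pos _).le⟩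
  push Not at hc
  set L₀ : ℝ := |Real.log (δ / 2)| with hL₀
  set K : ℝ := (p * (δ / 2) + L₀) + (p * L₀ + |Real.log c|) with hK
  have hK0 : 0 ≤ K := by positivity
  refine ⟨⌈2 / δ * K⌉₊ + 1, fun U hU => ?_⟩
  have hU1 : (1 : ℝ) ≤ U := by exact_mod_cast (le_trans (Nat.le_add_left 1 _) hU)
  have hUpos : (0 : ℝ) < U := by linarith
  have hUK : 2 / δ * K ≤ U :=
    le_trans (Nat.le_ceil _) (by exact_mod_cast (le_trans (Nat.le_succ _) hU))
  -- `log U ≤ (δ/2) U + L₀`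
  have hlogU : Real.log U ≤ δ / 2 * U + L₀ := by
    have h := Real.log_le_sub_one_of_pos (by positivity : (0 : ℝ) < δ / 2 * U)
    rw [Real.log_mul (by positivity) hUpos.ne'] at h
    have : -Real.log (δ / 2) ≤ L₀ := neg_le_abs _
    linarith
  -- `log c + (U + p) log U ≤ δ U²`
  have hmain : Real.log c + ((U : ℝ) + p) * Real.log U ≤ δ * (U : ℝ) ^ 2 := by
    have h1 : ((U : ℝ) + p) * Real.log U ≤ ((U : ℝ) + p) * (δ / 2 * U + L₀) :=
      mul_le_mul_of_nonneg_left hlogU (by positivity)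
    have h2 : Real.log c ≤ |Real.log c| := le_abs_self _
    have h3 : K * U ≤ δ / 2 * (U : ℝ) ^ 2 := by
      have h4 : K ≤ δ / 2 * U := by
        have := mul_le_mul_of_nonneg_left hUK (by positivity : (0 : ℝ) ≤ δ / 2)
        rwa [show δ / 2 * (2 / δ * K) = K by field_simp] at this
      nlinarith
    nlinarith [mul_le_mul_of_nonneg_left hU1 (by positivity : (0 : ℝ) ≤ p * L₀ + |Real.log c|)]
  -- exponentiate
  have hpos : 0 < c * (U : ℝ) ^ (U + p) := by positivity
  rw [← Real.exp_log hpos, Real.exp_le_exp, Real.log_mul hc.ne' (by positivity), Real.log_pow]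
  push_cast
  linarith

/-- **The schedule, quantitatively.**  For every `U₀` there is `N₀` such that for all `N ≥ N₀`:
`U₀ ≤ U(N)`, `16 ≤ N`, `exp(4 U(N)²) ≤ log N` and `log log N ≤ (2 U(N) + 2)²` (where
`U(N) = slowDegree N = max 4 ⌊√(log log N)/2⌋`: once `⌊√(log log N)/2⌋ ≥ 5` the schedule is the floor, which is
within `1` of `√(log log N)/2`). -/
theorem quantClip_schedule : ∀ U₀ : ℕ, ∃ N₀ : ℕ, ∀ N : ℕ, N₀ ≤ N → U₀ ≤ slowDegree N ∧ 16 ≤ N ∧ Real.exp (4 * (slowDegree N : ℝ) ^ 2) ≤ Real.log N ∧ Real.log (Real.log N) ≤ (2 * (slowDegree N : ℝ) + 2) ^ 2 := by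
  intro U₀
  obtain ⟨M, hM⟩ : ∃ M : ℕ, M = max U₀ 4 := ⟨_, rfl⟩
  have hM4 : 4 ≤ M := by rw [hM]; exact le_max_right _ _
  have hMU : U₀ ≤ M := by rw [hM]; exact le_max_left _ _
  obtain ⟨T, hT⟩ : ∃ T : ℝ, T = 4 * ((M : ℝ) + 1) ^ 2 := ⟨_, rfl⟩
  refine ⟨⌈Real.exp (Real.exp T)⌉₊, fun N hN => ?_⟩
  have hNreal : Real.exp (Real.exp T) ≤ N := le_trans (Nat.le_ceil _) (by exact_mod_cast hN)
  have hM4' : (4 : ℝ) ≤ M := by exact_mod_cast hM4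
  have hT100 : (100 : ℝ) ≤ T := by rw [hT]; nlinarith
  have hN0 : (0 : ℝ) < N := (Real.exp_pos _).trans_le hNreal
  have hL : Real.exp T ≤ Real.log N := by
    rw [Real.le_log_iff_exp_le hN0]; exact hNreal
  have hLpos : 0 < Real.log N := (Real.exp_pos T).trans_le hL
  have hLL : T ≤ Real.log (Real.log N) := by
    rw [Real.le_log_iff_exp_le hLpos]; exact hL
  have hll0 : 0 ≤ Real.log (Real.log N) := le_trans (by linarith) hLL
  have hN16 : 16 ≤ N := by
    have h1 : T + 1 ≤ Real.exp T := Real.add_one_le_exp T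
    have h2 : Real.exp T + 1 ≤ Real.exp (Real.exp T) := Real.add_one_le_exp _
    have h3 : (16 : ℝ) ≤ N := by linarith
    exact_mod_cast h3
  obtain ⟨s, hs⟩ : ∃ s : ℝ, s = Real.sqrt (Real.log (Real.log N)) / 2 := ⟨_, rfl⟩
  have hUdef : slowDegree N = max 4 ⌊s⌋₊ := by rw [hs]; rfl
  have hsM : (M : ℝ) + 1 ≤ s := by
    have h1 : Real.sqrt T ≤ Real.sqrt (Real.log (Real.log N)) := Real.sqrt_le_sqrt hLL
    have h2 : Real.sqrt T = 2 * ((M : ℝ) + 1) := by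
      rw [hT, show (4 : ℝ) * ((M : ℝ) + 1) ^ 2 = (2 * ((M : ℝ) + 1)) ^ 2 by ring]
      exact Real.sqrt_sq (by positivity)
    rw [hs]; linarith
  have hs0 : 0 ≤ s := le_trans (by positivity) hsM
  have hfloor : M + 1 ≤ ⌊s⌋₊ := Nat.le_floor (by exact_mod_cast hsM)
  have hU' : slowDegree N = ⌊s⌋₊ := by rw [hUdef]; exact max_eq_right (by omega)
  have hUs : (slowDegree N : ℝ) ≤ s := by rw [hU']; exact Nat.floor_le hs0
  have hsU : s < (slowDegree N : ℝ) + 1 := by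
    rw [hU']; exact_mod_cast Nat.lt_floor_add_one s
  have h2s : (2 * s) ^ 2 = Real.log (Real.log N) := by
    rw [hs, show 2 * (Real.sqrt (Real.log (Real.log N)) / 2) = Real.sqrt (Real.log (Real.log N)) by ring,
      Real.sq_sqrt hll0]
  have hU0 : (0 : ℝ) ≤ slowDegree N := Nat.cast_nonneg _
  refine ⟨?_, hN16, ?_, ?_⟩
  · calc U₀ ≤ M := hMU
      _ ≤ M + 1 := Nat.le_succ _
      _ ≤ slowDegree N := by rw [hU']; exact hfloor
  · have h4U : 4 * (slowDegree N : ℝ) ^ 2 ≤ Real.log (Real.log N) := by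
      have h1 : (2 * (slowDegree N : ℝ)) ^ 2 ≤ (2 * s) ^ 2 :=
        pow_le_pow_left₀ (by positivity) (by linarith) 2
      nlinarith
    calc Real.exp (4 * (slowDegree N : ℝ) ^ 2) ≤ Real.exp (Real.log (Real.log N)) :=
          Real.exp_le_exp.mpr h4U
      _ = Real.log N := Real.exp_log hLpos
  · have h1 : (2 * s) ^ 2 ≤ (2 * (slowDegree N : ℝ) + 2) ^ 2 :=
      pow_le_pow_left₀ (by positivity) (by linarith) 2
    linarith [h2s]

end Summit.Parity.GeneralizedHardyLittlewood.Cruxes.AbsoluteUpgrade.DipMarginRateExchange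

end
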